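import Mathlib
import HarnessLib
import Summits.Ventures.LatticeQCDFlow.Scaling.AutoregressiveGaugeRedundancyWilson
import Summits.Ventures.LatticeQCDFlow.Scaling.WilsonPlaquetteMateContext

/-!
# LatticeQCDFlow / Scaling — THEORY-2 §4 C5, gauge case: the assembled counterexample (symbolic
# context ∋ ℓ, weight couples ℓ, true context ∌ ℓ)

HONEST FRAMING: exact (Metropolis-corrected) sampling algorithms for lattice gauge theory;
figures of merit are autocorrelation/cost numbers at stated couplings and volumes; no
continuum-physics claim.

Venture `LatticeQCDFlow` (cell pub-lqcd), topic `Scaling`, FANOUT row 30 (lean-1, GEN-15) — OUR WORK,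
the one-name assembly of the files `Scaling/AutoregressiveGaugeRedundancy{,Wilson}` and
`Scaling/WilsonPlaquetteMate{Coupling,Context}` for THEORY-2.md §4 row C5 ("for the Wilson / φ⁴
lattice actions … the exact KR map in a given ordering has EXACTLY the symbolic sparsity").
**`c5_gauge_counterexample`**: every compact `G`, every CONTINUOUS representation `ρ` whose
character `Re tr ρ` is not constant, every `β ≠ 0`, every `d`, `L ≥ 3`, every site `x`, directions
`i ≠ j`; `ℓ = (x, i)`, `a = (x + e_j, i)`, `w = e^{−β S_W}`:
(i) `ℓ` is a neighbour of `a` in the plaquette-sharing graph (the SYMBOLIC context of `a` in every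
order generating `ℓ` before `a`);
(ii) with NOTHING integrated, the exact conditional density of `U_a` given all other links,
`w / A_{{a}} w`, READS `U_ℓ` (takes different values at some `U`, `U[ℓ ↦ h]`) — the coupling is real;
(iii) with the other links at `x` integrated (`s = star(x) ∖ {ℓ}` still to be generated), the exact
autoregressive conditional density `A_s w / A_{insert a s} w` of `U_a` does NOT read `U_ℓ`.
So along the order "`ℓ`, then the rest except `star(x)`, then `a`, then `star(x) ∖ {ℓ}`" the true
context of `a` is strictly smaller than its symbolic context: C5 as worded is false for the Wilson
action in link variables; its repair counts holonomy classes (`AutoregressiveGaugePlaquetteClass`).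
NOT CLAIMED: `L = 2`; constant characters; `φ⁴`; any number of ours.  No definition is introduced;
nothing is cited as a fact; no `sorry`.
-/

noncomputable section

namespace Summit.Ventures.LatticeQCDFlow.Theory2.Autoregressive

open MeasureTheory Function
open Literature.MathematicalPhysics.QuantumFieldTheory
open Summit.Ventures.LatticeQCDFlow.Exactness

variable {d L N : ℕ} {G : Type*} [Group G] [TopologicalSpace G] [IsTopologicalGroup G]
  [CompactSpace G] [MeasurableSpace G] [BorelSpace G] (ρ : G →* Matrix (Fin N) (Fin N) ℂ)

/-- **C5 (gauge case) — the assembled counterexample.**  See the module docstring: (i) symbolic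
adjacency, (ii) the full conditional reads the plaquette-mate, (iii) the marginalised autoregressive
conditional does not. [ours] -/
theorem c5_gauge_counterexample [NeZero L] (hL : 3 ≤ L) (hρ : Continuous ρ)
    (hnc : ∃ g : G, (ρ g).trace.re ≠ (ρ 1).trace.re) {β : ℝ} (hβ : β ≠ 0) (x : Site d L)
    {i j : Fin d} (hij : i ≠ j) :
    let w : GaugeConfig d L G → ℝ := fun U => Real.exp (-β * wilsonAction ρ U)
    let ℓ : Edge d L := (x, i)
    let a : Edge d L := (x.shift j, i)
    let s : Finset (Edge d L) :=
      (Finset.univ.filter fun e : Edge d L => e.1 = x ∨ e.1.shift e.2 = x).erase ℓ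
    ℓ ∈ Luscher2010.plaqNbhd a ∧
      (∃ (U : GaugeConfig d L G) (h : G),
        w (update U ℓ h) / coordAvg (haarProbability G) {a} w (update U ℓ h) ≠
          w U / coordAvg (haarProbability G) {a} w U) ∧
      (a ∉ s ∧ ℓ ∉ s ∧ ∀ (U : GaugeConfig d L G) (h : G),
        coordAvg (haarProbability G) s w (update U ℓ h) /
            coordAvg (haarProbability G) (insert a s) w (update U ℓ h) =
          coordAvg (haarProbability G) s w U / coordAvg (haarProbability G) (insert a s) w U) := by
  intro w ℓ a s
  have hL2 : 2 ≤ L := by omega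
  refine ⟨mem_plaqNbhd_mate x hij, wilson_fullConditional_reads_mate ρ hL hρ hnc x hij hβ,
    (wilson_arConditional_plaquetteMate_dropout ρ hL2 β x hij 1 1).2.1,
    (wilson_arConditional_plaquetteMate_dropout ρ hL2 β x hij 1 1).2.2.1, fun U h => ?_⟩
  exact (wilson_arConditional_plaquetteMate_dropout ρ hL2 β x hij U h).2.2.2

end Summit.Ventures.LatticeQCDFlow.Theory2.Autoregressive

end
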